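/-
COR-CM (cell pub-hodgecm2, stage 2 of the Hodge ladder) — count-neutral KERNEL COMBINATORICS «the octic product column G = Q₈ × B, D₄ × B: the spanning trees over the central y»
(seat prover-pub-hodgecm2-b23-g45-0, binder prover b23, gen 45; own census lane OCTIC-PRODUCT, claim HOME/INBOX.md l.18829).  Theorems only — the spanning-tree chains of gen 44ʼs `Census/QuarticInversionTrees.lean` (closing family `famB1`, BY NAME) re-run over the orbit span under the CENTRAL `y` (`Census/OcticProductOrbit.lean`: `Z_mem`/`Z_mem'` have the pattern bookkeeping of gen 44ʼs `Y_mem`/`Y_mem'`); `decide` only on closed identities of `Bool`/`Fin 4` literals, no certificate, no named fact, no `sorry`.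
`Interfaces.lean` (C1), every E term, B01, `Transposition/*`, `PortJoin/*`, `D2Bridge/*` untouched.
HONEST FRAMING: `HC_CM` is NOT proved, here or anywhere in the tree; nothing here is a period, a count of record or a headline.
T5: n/a-class (hypothesis binders = the datum equations / the slot data only); checker: self, 2026-08-24.
-/
import Summits.HodgeConjecture.CorCM.Census.QuarticInversionTrees
import Summits.HodgeConjecture.CorCM.Census.OcticProductOrbit

/-!
# The octic product column: the closing family `B1` and the spanning trees over the central `y` — every slot binomial lies in its value module

COR-CM (cell `pub-hodgecm2`, stage 2 of the Hodge ladder), count-neutral KERNEL COMBINATORICS by the binder seat b23 (gen 45; lane OCTIC-PRODUCT, HOME/INBOX.md l.18829 — the port of gen 44ʼs quartic inversion lane `Census/QuarticInversion*` to the datum with `y` CENTRAL on `ι(H₀)`).  On top of gen 44ʼs parts I–XVII (the closing family `famB1` and its members, `Census/QuarticInversionTrees.lean`) and `Census/OcticProduct{Equivariance,Orbit}`, all BY NAME.  Theorems only; `decide` only on closed identities of `Bool`/`Fin 4`/`Fin 4 → Bool` literals (masks,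
pattern maps of part XIV at literal patterns), no certificate, no named fact, no geometry, no `sorry`.  The chains of §3 were found by a
breadth-first search (this folder's `work/gen/trees.py`) and are checked here by the kernel.  `Interfaces.lean` (C1), every E term, B01,
`Transposition/*`, `PortJoin/*` untouched.
HONEST FRAMING: `HC_CM` is NOT proved, here or anywhere in the tree; nothing here is a period, a count of record or a headline.

CONTENT (`|B|` odd `≥ 3`, square class `ζ`; a slot datum `(P, u₁, u₂ ; Q, w, u₀)` with `|P| + 1 = K`, `u₁ ≠ u₂ ∉ P`, `|Q| = K`, `w ∉ Q`, and a
cross datum `(σ, s₀)` for `P⁺ = P ∪ {u₁, u₂}` as in part XVI).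
* §1 **The closing family `B1`** (ten faces): the equator-crossing squares `S_b` for `b ∈ {TTT, FFF, TTF, FFT, TFT}` (halves of the constant
  coordinates `1,2,3`; `T` = the zero slice) and the mixed faces `M(1;TTT), M(2;TTT), M(1;TFT), M(1;TFF), M(1;TTF)`.
* §2 **Edges at the atom coordinate `1`**: the four parallel binomials (direction `0`, every background) from the `M(1;·)`, two antipodal ones from
  the cross trick moved by `y`, and one more (direction `3`) from `M(2;TTT)` moved by `y` then `t`; §3 **the spanning tree**: chains of these
  (and the free flips at coordinate `1`) join every pattern to the root, so EVERY slot binomial of coordinate `1` lies in the value module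
  (`toRoot_one`, `all_one`), for `ζ = 0` and `ζ = 1` separately (the masks differ).
* §4 Moving by `y`, `t`, `y` again: every slot binomial of EVERY coordinate lies in the value module (`all_bin`).  All [folklore].

## References
* [Pohlmann1968] H. Pohlmann, Algebraic cycles on abelian varieties of complex multiplication type, Ann. of Math. 88 (1968), Thm 1.
-/

namespace Summit.HodgeConjecture.CorCM.Census.OcticProduct

open Finset
open Summit.HodgeConjecture.CorCM.Census.OddSliceFacesModel

open Summit.HodgeConjecture.CorCM.Census.QuarticInversion (Y_mem Y_mem' bY binVec famB1 memJ memS memT mem_M1_TFF mem_M1_TFT mem_M1_TTF mem_M1_TTT mem_M2_TTT mem_S_FFF mem_S_FFT mem_S_TTF mem_S_TTT pT pY qT_pT qY_pY σT σY)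

noncomputable section

variable (A : Type) [AddCommGroup A] [Fintype A] [DecidableEq A]

/-! ## §2–§3 Edges and spanning trees at the atom coordinate `1` -/

section Trees
variable {P : Finset A} {u₁ u₂ : A} {Q : Finset A} {w u₀ σ s₀ : A}

/-- **Every pattern is joined to the root at coordinate `1`** (`ζ = 0` and `ζ = 1`): for every pattern `a` and slot `u`,
`binVec 1 a FFFF u` lies in the value module of `B1`. [folklore] -/
theorem toRoot_one (hA : Odd (Fintype.card A)) (h3 : 3 ≤ Fintype.card A) (ζ : ZMod 2) (h1 : u₁ ∉ P) (h2 : u₂ ∉ P) (h12 : u₁ ≠ u₂)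
    (hP : P.card + 1 = Fintype.card A / 2) (hs₀ : s₀ ∈ insert u₁ (insert u₂ P))
    (hX : ∀ s, s + σ ∈ insert u₁ (insert u₂ P) ↔ (s ∉ insert u₁ (insert u₂ P) ∨ s = s₀)) (hw : w ∉ Q)
    (hQ : Q.card = Fintype.card A / 2) (a : Fin 4 → Bool) (u : A) :
    binVec A 1 a ![false, false, false, false] u ∈ valMod A ζ ↑(famB1 A P u₁ u₂ Q w u₀) := by
  have ea : a = ![a 0, a 1, a 2, a 3] := by funext n; fin_cases n <;> rfl
  rw [ea]
  have h01 : ∀ z : ZMod 2, z = 0 ∨ z = 1 := by decide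
  rcases h01 ζ with rfl | rfl
  · have key : ∀ a0 a1 a2 a3 : Bool,
        binVec A 1 ![a0, a1, a2, a3] ![false, false, false, false] u ∈ valMod A 0 ↑(famB1 A P u₁ u₂ Q w u₀) := by
      intro a0 a1 a2 a3
      have m1 : binVec A 1 ![false, false, false, false] ![true, false, false, false] u ∈ valMod A 0 ↑(famB1 A P u₁ u₂ Q w u₀) :=
        mix_mem A hA h3 hw hQ (i := 1) (by decide) (b := ![false, true, true, true]) (by decide) (mem_M1_TTT A P u₁ u₂ Q w u₀) (by decide) (by decide) u
      have m2 : binVec A 2 ![false, false, false, false] ![true, false, false, false] u ∈ valMod A 0 ↑(famB1 A P u₁ u₂ Q w u₀) :=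
        mix_mem A hA h3 hw hQ (i := 2) (by decide) (b := ![false, true, true, true]) (by decide) (mem_M2_TTT A P u₁ u₂ Q w u₀) (by decide) (by decide) u
      have m3 : binVec A 1 ![false, false, true, false] ![true, false, true, false] u ∈ valMod A 0 ↑(famB1 A P u₁ u₂ Q w u₀) :=
        mix_mem A hA h3 hw hQ (i := 1) (by decide) (b := ![false, true, false, true]) (by decide) (mem_M1_TFT A P u₁ u₂ Q w u₀) (by decide) (by decide) u
      have m4 : binVec A 1 ![false, false, true, true] ![true, false, true, true] u ∈ valMod A 0 ↑(famB1 A P u₁ u₂ Q w u₀) :=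
        mix_mem A hA h3 hw hQ (i := 1) (by decide) (b := ![false, true, false, false]) (by decide) (mem_M1_TFF A P u₁ u₂ Q w u₀) (by decide) (by decide) u
      have m5 : binVec A 1 ![false, false, false, true] ![true, false, false, true] u ∈ valMod A 0 ↑(famB1 A P u₁ u₂ Q w u₀) :=
        mix_mem A hA h3 hw hQ (i := 1) (by decide) (b := ![false, true, true, false]) (by decide) (mem_M1_TTF A P u₁ u₂ Q w u₀) (by decide) (by decide) u
      have x6 : binVec A 0 ![true, false, false, false] ![false, true, true, true] u ∈ valMod A 0 ↑(famB1 A P u₁ u₂ Q w u₀) :=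
        cross_mem A hA h1 h2 h12 hP hs₀ hX (b := ![false, true, true, true]) (mem_S_TTT A P u₁ u₂ Q w u₀) (mem_S_FFF A P u₁ u₂ Q w u₀) (by decide) u
      have x7 : binVec A 0 ![true, false, false, true] ![false, true, true, false] u ∈ valMod A 0 ↑(famB1 A P u₁ u₂ Q w u₀) :=
        cross_mem A hA h1 h2 h12 hP hs₀ hX (b := ![false, true, true, false]) (mem_S_TTF A P u₁ u₂ Q w u₀) (mem_S_FFT A P u₁ u₂ Q w u₀) (by decide) u
      have y8 : binVec A 1 ![false, true, false, false] ![true, false, true, true] u ∈ valMod A 0 ↑(famB1 A P u₁ u₂ Q w u₀) :=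
        Z_mem A hA (j := 0) (by decide) (by decide) (by decide) (by decide) x6 u
      have y9 : binVec A 1 ![false, true, true, false] ![true, false, false, true] u ∈ valMod A 0 ↑(famB1 A P u₁ u₂ Q w u₀) :=
        Z_mem A hA (j := 0) (by decide) (by decide) (by decide) (by decide) x7 u
      have y10 : binVec A 3 ![false, false, false, false] ![false, true, false, false] u ∈ valMod A 0 ↑(famB1 A P u₁ u₂ Q w u₀) :=
        Z_mem A hA (j := 2) (by decide) (by decide) (by decide) (by decide) m2 u
      have t11 : binVec A 1 ![true, false, false, false] ![true, false, false, true] u ∈ valMod A 0 ↑(famB1 A P u₁ u₂ Q w u₀) :=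
        T_mem' A hA (j := 3) (by decide) (by decide) (by decide) (by decide) y10 u
      have c0000 : binVec A 1 ![false, false, false, false] ![false, false, false, false] u ∈ valMod A 0 ↑(famB1 A P u₁ u₂ Q w u₀) :=
        memJ A _ (a := ![false, false, false, false]) (b := ![false, false, false, false]) (fun _ _ => rfl) u
      have c1000 : binVec A 1 ![true, false, false, false] ![false, false, false, false] u ∈ valMod A 0 ↑(famB1 A P u₁ u₂ Q w u₀) :=
        memT A (memS A m1) c0000
      have c0100 : binVec A 1 ![false, true, false, false] ![false, false, false, false] u ∈ valMod A 0 ↑(famB1 A P u₁ u₂ Q w u₀) :=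
        memT A (memJ A _ (a := ![false, true, false, false]) (b := ![false, false, false, false]) (by decide) u) c0000
      have c1001 : binVec A 1 ![true, false, false, true] ![false, false, false, false] u ∈ valMod A 0 ↑(famB1 A P u₁ u₂ Q w u₀) :=
        memT A (memS A t11) c1000
      have c1100 : binVec A 1 ![true, true, false, false] ![false, false, false, false] u ∈ valMod A 0 ↑(famB1 A P u₁ u₂ Q w u₀) :=
        memT A (memJ A _ (a := ![true, true, false, false]) (b := ![true, false, false, false]) (by decide) u) c1000
      have c1011 : binVec A 1 ![true, false, true, true] ![false, false, false, false] u ∈ valMod A 0 ↑(famB1 A P u₁ u₂ Q w u₀) :=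
        memT A (memS A y8) c0100
      have c0001 : binVec A 1 ![false, false, false, true] ![false, false, false, false] u ∈ valMod A 0 ↑(famB1 A P u₁ u₂ Q w u₀) :=
        memT A m5 c1001
      have c0110 : binVec A 1 ![false, true, true, false] ![false, false, false, false] u ∈ valMod A 0 ↑(famB1 A P u₁ u₂ Q w u₀) :=
        memT A y9 c1001
      have c1101 : binVec A 1 ![true, true, false, true] ![false, false, false, false] u ∈ valMod A 0 ↑(famB1 A P u₁ u₂ Q w u₀) :=
        memT A (memJ A _ (a := ![true, true, false, true]) (b := ![true, false, false, true]) (by decide) u) c1001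
      have c0011 : binVec A 1 ![false, false, true, true] ![false, false, false, false] u ∈ valMod A 0 ↑(famB1 A P u₁ u₂ Q w u₀) :=
        memT A m4 c1011
      have c1111 : binVec A 1 ![true, true, true, true] ![false, false, false, false] u ∈ valMod A 0 ↑(famB1 A P u₁ u₂ Q w u₀) :=
        memT A (memJ A _ (a := ![true, true, true, true]) (b := ![true, false, true, true]) (by decide) u) c1011
      have c0101 : binVec A 1 ![false, true, false, true] ![false, false, false, false] u ∈ valMod A 0 ↑(famB1 A P u₁ u₂ Q w u₀) :=
        memT A (memJ A _ (a := ![false, true, false, true]) (b := ![false, false, false, true]) (by decide) u) c0001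
      have c0010 : binVec A 1 ![false, false, true, false] ![false, false, false, false] u ∈ valMod A 0 ↑(famB1 A P u₁ u₂ Q w u₀) :=
        memT A (memJ A _ (a := ![false, false, true, false]) (b := ![false, true, true, false]) (by decide) u) c0110
      have c0111 : binVec A 1 ![false, true, true, true] ![false, false, false, false] u ∈ valMod A 0 ↑(famB1 A P u₁ u₂ Q w u₀) :=
        memT A (memJ A _ (a := ![false, true, true, true]) (b := ![false, false, true, true]) (by decide) u) c0011
      have c1010 : binVec A 1 ![true, false, true, false] ![false, false, false, false] u ∈ valMod A 0 ↑(famB1 A P u₁ u₂ Q w u₀) :=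
        memT A (memS A m3) c0010
      have c1110 : binVec A 1 ![true, true, true, false] ![false, false, false, false] u ∈ valMod A 0 ↑(famB1 A P u₁ u₂ Q w u₀) :=
        memT A (memJ A _ (a := ![true, true, true, false]) (b := ![true, false, true, false]) (by decide) u) c1010
      cases a0 <;> cases a1 <;> cases a2 <;> cases a3
      exacts [c0000, c0001, c0010, c0011, c0100, c0101, c0110, c0111, c1000, c1001, c1010, c1011, c1100, c1101, c1110, c1111]
    exact key _ _ _ _
  · have key : ∀ a0 a1 a2 a3 : Bool,
        binVec A 1 ![a0, a1, a2, a3] ![false, false, false, false] u ∈ valMod A 1 ↑(famB1 A P u₁ u₂ Q w u₀) := by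
      intro a0 a1 a2 a3
      have m1 : binVec A 1 ![false, false, false, false] ![true, false, false, false] u ∈ valMod A 1 ↑(famB1 A P u₁ u₂ Q w u₀) :=
        mix_mem A hA h3 hw hQ (i := 1) (by decide) (b := ![false, true, true, true]) (by decide) (mem_M1_TTT A P u₁ u₂ Q w u₀) (by decide) (by decide) u
      have m2 : binVec A 2 ![false, false, false, false] ![true, false, false, false] u ∈ valMod A 1 ↑(famB1 A P u₁ u₂ Q w u₀) :=
        mix_mem A hA h3 hw hQ (i := 2) (by decide) (b := ![false, true, true, true]) (by decide) (mem_M2_TTT A P u₁ u₂ Q w u₀) (by decide) (by decide) u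
      have m3 : binVec A 1 ![false, false, true, false] ![true, false, true, false] u ∈ valMod A 1 ↑(famB1 A P u₁ u₂ Q w u₀) :=
        mix_mem A hA h3 hw hQ (i := 1) (by decide) (b := ![false, true, false, true]) (by decide) (mem_M1_TFT A P u₁ u₂ Q w u₀) (by decide) (by decide) u
      have m4 : binVec A 1 ![false, false, true, true] ![true, false, true, true] u ∈ valMod A 1 ↑(famB1 A P u₁ u₂ Q w u₀) :=
        mix_mem A hA h3 hw hQ (i := 1) (by decide) (b := ![false, true, false, false]) (by decide) (mem_M1_TFF A P u₁ u₂ Q w u₀) (by decide) (by decide) u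
      have m5 : binVec A 1 ![false, false, false, true] ![true, false, false, true] u ∈ valMod A 1 ↑(famB1 A P u₁ u₂ Q w u₀) :=
        mix_mem A hA h3 hw hQ (i := 1) (by decide) (b := ![false, true, true, false]) (by decide) (mem_M1_TTF A P u₁ u₂ Q w u₀) (by decide) (by decide) u
      have x6 : binVec A 0 ![true, false, false, false] ![false, true, true, true] u ∈ valMod A 1 ↑(famB1 A P u₁ u₂ Q w u₀) :=
        cross_mem A hA h1 h2 h12 hP hs₀ hX (b := ![false, true, true, true]) (mem_S_TTT A P u₁ u₂ Q w u₀) (mem_S_FFF A P u₁ u₂ Q w u₀) (by decide) u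
      have x7 : binVec A 0 ![true, false, false, true] ![false, true, true, false] u ∈ valMod A 1 ↑(famB1 A P u₁ u₂ Q w u₀) :=
        cross_mem A hA h1 h2 h12 hP hs₀ hX (b := ![false, true, true, false]) (mem_S_TTF A P u₁ u₂ Q w u₀) (mem_S_FFT A P u₁ u₂ Q w u₀) (by decide) u
      have y8 : binVec A 1 ![false, false, false, true] ![true, true, true, false] u ∈ valMod A 1 ↑(famB1 A P u₁ u₂ Q w u₀) :=
        Z_mem' A hA (j := 0) (by decide) (by decide) (by decide) (by decide) x6 u
      have y9 : binVec A 1 ![false, false, true, true] ![true, true, false, false] u ∈ valMod A 1 ↑(famB1 A P u₁ u₂ Q w u₀) :=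
        Z_mem' A hA (j := 0) (by decide) (by decide) (by decide) (by decide) x7 u
      have y10 : binVec A 3 ![true, true, true, false] ![true, false, true, false] u ∈ valMod A 1 ↑(famB1 A P u₁ u₂ Q w u₀) :=
        Z_mem' A hA (j := 2) (by decide) (by decide) (by decide) (by decide) m2 u
      have t11 : binVec A 1 ![false, false, true, true] ![false, false, true, false] u ∈ valMod A 1 ↑(famB1 A P u₁ u₂ Q w u₀) :=
        T_mem' A hA (j := 3) (by decide) (by decide) (by decide) (by decide) y10 u
      have c0000 : binVec A 1 ![false, false, false, false] ![false, false, false, false] u ∈ valMod A 1 ↑(famB1 A P u₁ u₂ Q w u₀) :=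
        memJ A _ (a := ![false, false, false, false]) (b := ![false, false, false, false]) (fun _ _ => rfl) u
      have c1000 : binVec A 1 ![true, false, false, false] ![false, false, false, false] u ∈ valMod A 1 ↑(famB1 A P u₁ u₂ Q w u₀) :=
        memT A (memS A m1) c0000
      have c0100 : binVec A 1 ![false, true, false, false] ![false, false, false, false] u ∈ valMod A 1 ↑(famB1 A P u₁ u₂ Q w u₀) :=
        memT A (memJ A _ (a := ![false, true, false, false]) (b := ![false, false, false, false]) (by decide) u) c0000
      have c1100 : binVec A 1 ![true, true, false, false] ![false, false, false, false] u ∈ valMod A 1 ↑(famB1 A P u₁ u₂ Q w u₀) :=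
        memT A (memJ A _ (a := ![true, true, false, false]) (b := ![true, false, false, false]) (by decide) u) c1000
      have c0011 : binVec A 1 ![false, false, true, true] ![false, false, false, false] u ∈ valMod A 1 ↑(famB1 A P u₁ u₂ Q w u₀) :=
        memT A y9 c1100
      have c1011 : binVec A 1 ![true, false, true, true] ![false, false, false, false] u ∈ valMod A 1 ↑(famB1 A P u₁ u₂ Q w u₀) :=
        memT A (memS A m4) c0011
      have c0010 : binVec A 1 ![false, false, true, false] ![false, false, false, false] u ∈ valMod A 1 ↑(famB1 A P u₁ u₂ Q w u₀) :=
        memT A (memS A t11) c0011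
      have c0111 : binVec A 1 ![false, true, true, true] ![false, false, false, false] u ∈ valMod A 1 ↑(famB1 A P u₁ u₂ Q w u₀) :=
        memT A (memJ A _ (a := ![false, true, true, true]) (b := ![false, false, true, true]) (by decide) u) c0011
      have c1111 : binVec A 1 ![true, true, true, true] ![false, false, false, false] u ∈ valMod A 1 ↑(famB1 A P u₁ u₂ Q w u₀) :=
        memT A (memJ A _ (a := ![true, true, true, true]) (b := ![true, false, true, true]) (by decide) u) c1011
      have c1010 : binVec A 1 ![true, false, true, false] ![false, false, false, false] u ∈ valMod A 1 ↑(famB1 A P u₁ u₂ Q w u₀) :=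
        memT A (memS A m3) c0010
      have c0110 : binVec A 1 ![false, true, true, false] ![false, false, false, false] u ∈ valMod A 1 ↑(famB1 A P u₁ u₂ Q w u₀) :=
        memT A (memJ A _ (a := ![false, true, true, false]) (b := ![false, false, true, false]) (by decide) u) c0010
      have c1110 : binVec A 1 ![true, true, true, false] ![false, false, false, false] u ∈ valMod A 1 ↑(famB1 A P u₁ u₂ Q w u₀) :=
        memT A (memJ A _ (a := ![true, true, true, false]) (b := ![true, false, true, false]) (by decide) u) c1010
      have c0001 : binVec A 1 ![false, false, false, true] ![false, false, false, false] u ∈ valMod A 1 ↑(famB1 A P u₁ u₂ Q w u₀) :=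
        memT A y8 c1110
      have c1001 : binVec A 1 ![true, false, false, true] ![false, false, false, false] u ∈ valMod A 1 ↑(famB1 A P u₁ u₂ Q w u₀) :=
        memT A (memS A m5) c0001
      have c0101 : binVec A 1 ![false, true, false, true] ![false, false, false, false] u ∈ valMod A 1 ↑(famB1 A P u₁ u₂ Q w u₀) :=
        memT A (memJ A _ (a := ![false, true, false, true]) (b := ![false, false, false, true]) (by decide) u) c0001
      have c1101 : binVec A 1 ![true, true, false, true] ![false, false, false, false] u ∈ valMod A 1 ↑(famB1 A P u₁ u₂ Q w u₀) :=
        memT A (memJ A _ (a := ![true, true, false, true]) (b := ![true, false, false, true]) (by decide) u) c1001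
      cases a0 <;> cases a1 <;> cases a2 <;> cases a3
      exacts [c0000, c0001, c0010, c0011, c0100, c0101, c0110, c0111, c1000, c1001, c1010, c1011, c1100, c1101, c1110, c1111]
    exact key _ _ _ _

/-- **Every slot binomial of coordinate `1` lies in the value module of `B1`.** [folklore] -/
theorem all_one (hA : Odd (Fintype.card A)) (h3 : 3 ≤ Fintype.card A) (ζ : ZMod 2) (h1 : u₁ ∉ P) (h2 : u₂ ∉ P) (h12 : u₁ ≠ u₂)
    (hP : P.card + 1 = Fintype.card A / 2) (hs₀ : s₀ ∈ insert u₁ (insert u₂ P))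
    (hX : ∀ s, s + σ ∈ insert u₁ (insert u₂ P) ↔ (s ∉ insert u₁ (insert u₂ P) ∨ s = s₀)) (hw : w ∉ Q)
    (hQ : Q.card = Fintype.card A / 2) (h h' : Fin 4 → Bool) (u : A) :
    binVec A 1 h h' u ∈ valMod A ζ ↑(famB1 A P u₁ u₂ Q w u₀) :=
  memT A (toRoot_one A hA h3 ζ h1 h2 h12 hP hs₀ hX hw hQ h u) (memS A (toRoot_one A hA h3 ζ h1 h2 h12 hP hs₀ hX hw hQ h' u))

/-! ## §4 Every slot binomial of every coordinate -/

/-- **EVERY slot binomial lies in the value module of `B1`** (coordinate `1` by the trees; `0 = σY 1`, `3 = σT 1`, `2 = σY 3` by the unmasked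
motions). [folklore] -/
theorem all_bin (hA : Odd (Fintype.card A)) (h3 : 3 ≤ Fintype.card A) (ζ : ZMod 2) (h1 : u₁ ∉ P) (h2 : u₂ ∉ P) (h12 : u₁ ≠ u₂)
    (hP : P.card + 1 = Fintype.card A / 2) (hs₀ : s₀ ∈ insert u₁ (insert u₂ P))
    (hX : ∀ s, s + σ ∈ insert u₁ (insert u₂ P) ↔ (s ∉ insert u₁ (insert u₂ P) ∨ s = s₀)) (hw : w ∉ Q)
    (hQ : Q.card = Fintype.card A / 2) (j : Fin 4) (g g' : Fin 4 → Bool) (u : A) :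
    binVec A j g g' u ∈ valMod A ζ ↑(famB1 A P u₁ u₂ Q w u₀) := by
  have H1 := all_one A hA h3 ζ h1 h2 h12 hP hs₀ hX hw hQ (u₀ := u₀)
  have hb0 : bY ζ (σY 1) = false := by
    have h01 : ∀ z : ZMod 2, z = 0 ∨ z = 1 := by decide
    rcases h01 ζ with rfl | rfl <;> decide
  have H0 : ∀ (g g' : Fin 4 → Bool) (u : A), binVec A 0 g g' u ∈ valMod A ζ ↑(famB1 A P u₁ u₂ Q w u₀) := fun g g' u =>
    Z_mem A hA (j := 1) hb0 (by decide) (qY_pY ζ g) (qY_pY ζ g') (H1 (pY ζ g) (pY ζ g') u) u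
  have H3 : ∀ (g g' : Fin 4 → Bool) (u : A), binVec A 3 g g' u ∈ valMod A ζ ↑(famB1 A P u₁ u₂ Q w u₀) := fun g g' u =>
    T_mem A hA (j := 1) (by decide) (by decide) (qT_pT g) (qT_pT g') (H1 (pT g) (pT g') u) u
  have hb2 : bY ζ (σY 3) = false := by
    have h01 : ∀ z : ZMod 2, z = 0 ∨ z = 1 := by decide
    rcases h01 ζ with rfl | rfl <;> decide
  have H2 : ∀ (g g' : Fin 4 → Bool) (u : A), binVec A 2 g g' u ∈ valMod A ζ ↑(famB1 A P u₁ u₂ Q w u₀) := fun g g' u =>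
    Z_mem A hA (j := 3) hb2 (by decide) (qY_pY ζ g) (qY_pY ζ g') (H3 (pY ζ g) (pY ζ g') u) u
  fin_cases j
  · exact H0 g g' u
  · exact H1 g g' u
  · exact H2 g g' u
  · exact H3 g g' u

end Trees

end

end Summit.HodgeConjecture.CorCM.Census.OcticProduct
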